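import Summits.QuantumAdvantage.QuantumAdvantage.Theorems.SosSandwichTransferPBLayoutCopies
import Summits.QuantumAdvantage.QuantumAdvantage.Theorems.SosSandwichTransferPBThresholdFP
import HarnessLib

/-!
# Crux `TransferPB` (stmt-QuantumAdvantage-15238, route SosSandwich), line `birth` — the node-test THRESHOLDS read off the layout with copies

Obligation (Q) of stub `stub_pbOracleSimulation`. The read-out layer (`PolyBlockStatReadout.mem_PromiseBQP_of_blockStat_thresholds_pre`)
compares the block statistic with a rational threshold `⟦num z⟧/⟦den z⟧` computed in `FP` from the laid-out instance
`z = layoutC F v` (`Theorems/…LayoutCopies.lean`). This file supplies `num`/`den` for all three kinds of node tests: the instance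
`v = ⟨x, ⟨P, t⟩⟩` is read back off the layout (`instOfC`: drop the `(T(n)+1)·n` copies, first field), its tag-and-target field `t`
decides the kind (`1 1^j` MEAN, `01σ` SINGLE, `00u` BLOCK):

* `instOfC`, `tagOfC`, `isMeanC` and their values on `layoutC F ⟨x, ⟨P, t⟩⟩`;
* **`nodeNum F z`** (`2j − 1` for MEAN, `3` otherwise) and **`nodeDen F r c k z`** (`80` for MEAN, `16 · T(n) · W(n)` otherwise,
  `W = ⟦wDenFn⟧ = 1/w`, `Theorems/…ThresholdFP.lean`): the MEAN threshold `(2j−1)/80` separates `j/40` from `(j−1)/40`, the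
  magnitude threshold `3/(16 T W) = (3/4)·w/(4T)` separates the statistic means `≥ w/(4T)` (YES) from `≤ w/(8T)` (NO);
* values on the three layouts (`nodeNum_layoutC_encMean`, `nodeDen_layoutC_encMean`, `nodeNum_layoutC_encSingle`, …);
* **`nodeNumC`** — the numerator is computed on codes for uniform `F` (the denominator's `CodeFP` — `wDenFn` on `1^{nOfLayout |z|}`,
  `codeFP_oracleQueries_un` — is left to the assembly file).

All proved; definitions are explicit. No named fact. Sources: S. Aaronson, A. Ambainis, Theory Comput. 10 (2014), proof of
Thm. 23 (p. 14); S. Arora, B. Barak, Computational Complexity (CUP 2009), §1.3.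
-/

-- D-0017: single-conjunct summit ⇒ the duplicate `QuantumAdvantage.QuantumAdvantage` is mandated.
set_option linter.dupNamespace false

noncomputable section

namespace Summit.QuantumAdvantage.QuantumAdvantage.Cruxes.TransferPB.Birth

open Finset Literature.Computability.Cryptography Literature.Computability.Complexity
  Literature.Computability.Complexity.Brick Literature.Computability.Complexity.Plumb
  Literature.Computability.QuantumComplexity Literature.Computability.QuantumComplexity.ClassicalSimulation
  Literature.Computability.Cryptography.ExplicitKWiseHash
open _root_.Computability CodeFP Polynomial

namespace SimTreePB

variable (F : QCircuitFamily cliffordT) (r : Polynomial ℕ) (c k : ℕ)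

/-! ### Reading the instance back off the layout -/

/-- **The instance read off the layout**: drop the `(T(n)+1)·n` copies of `x` (`n = nOfLayout |z|`), take the first field.
[cite: AroraBarak2009, §1.3] -/
def instOfC (z : List Bool) : List Bool := fstF (z.drop (blocksOf F (nOfLayout z.length) * nOfLayout z.length))

/-- The tag-and-target field `t` of the instance `⟨x, ⟨P, t⟩⟩`. [cite: AroraBarak2009, §1.3] -/
def tagOfC (z : List Bool) : List Bool := sndF (sndF (instOfC F z))

/-- The MEAN flag: the tag field starts with `1`. [cite: AaronsonAmbainis2014, Thm. 23 (proof, p. 14)] -/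
def isMeanC (z : List Bool) : Bool := (tagOfC F z).getD 0 false

/-- **The threshold numerator**: `2j − 1` (MEAN, `t = 1 1^j`), else `3`. [cite: AaronsonAmbainis2014, Thm. 23 (proof, p. 14)] -/
def nodeNum (z : List Bool) : ℕ := if isMeanC F z then 2 * ((tagOfC F z).length - 1) - 1 else 3

/-- **The threshold denominator**: `80` (MEAN), else `16 · T(n) · W(n)`. [cite: AaronsonAmbainis2014, Thm. 23 (proof, p. 14)] -/
def nodeDen (z : List Bool) : ℕ :=
  if isMeanC F z then 80
  else 16 * (F.circ (nOfLayout z.length)).oracleQueries * bitsToNat (wDenFn F r c k (ones (nOfLayout z.length)))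

/-- The instance read off its layout. [folklore] -/
theorem instOfC_layoutC (x w : List Bool) : instOfC F (layoutC F (boolPair x w)) = boolPair x w := by
  rw [instOfC, nOfLayout_layoutC, layoutC, fstF_boolPair, List.drop_left' (copies_length _ _), paramStr, fstF_boolPair]

/-- The tag field read off the layout. [folklore] -/
theorem tagOfC_layoutC (x P t : List Bool) : tagOfC F (layoutC F (boolPair x (boolPair P t))) = t := by
  rw [tagOfC, instOfC_layoutC, sndF_boolPair, sndF_boolPair]

variable (x : List Bool) (ρ : List (Fin (numOracleBits F x) × Bool))

/-- MEAN layouts are flagged MEAN, with numerator `2j − 1` and denominator `80`. [cite: AaronsonAmbainis2014, Thm. 23 (proof, p. 14)] -/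
theorem node_layoutC_encMean (j : ℕ) :
    isMeanC F (layoutC F (encMean F x ρ j)) = true ∧ nodeNum F (layoutC F (encMean F x ρ j)) = 2 * j - 1 ∧
      nodeDen F r c k (layoutC F (encMean F x ρ j)) = 80 := by
  have ht : tagOfC F (layoutC F (encMean F x ρ j)) = true :: List.replicate j true := tagOfC_layoutC F x _ _
  have hm : isMeanC F (layoutC F (encMean F x ρ j)) = true := by rw [isMeanC, ht]; rfl
  refine ⟨hm, ?_, ?_⟩
  · rw [nodeNum, if_pos hm, ht, List.length_cons, List.length_replicate]; omega
  · rw [nodeDen, if_pos hm]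

/-- SINGLE layouts are flagged non-MEAN, with numerator `3` and denominator `16 T(|x|) W(|x|)`.
[cite: AaronsonAmbainis2014, Thm. 23 (proof, p. 14)] -/
theorem node_layoutC_encSingle (s : Fin (numOracleBits F x)) :
    isMeanC F (layoutC F (encSingle F x ρ s)) = false ∧ nodeNum F (layoutC F (encSingle F x ρ s)) = 3 ∧
      nodeDen F r c k (layoutC F (encSingle F x ρ s)) =
        16 * (F.circ x.length).oracleQueries * bitsToNat (wDenFn F r c k (ones x.length)) := by
  have ht : tagOfC F (layoutC F (encSingle F x ρ s)) = false :: true :: bitString F x s := tagOfC_layoutC F x _ _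
  have hm : isMeanC F (layoutC F (encSingle F x ρ s)) = false := by rw [isMeanC, ht]; rfl
  refine ⟨hm, ?_, ?_⟩
  · rw [nodeNum, hm]; rfl
  · rw [nodeDen, hm]
    simp only [Bool.false_eq_true, if_false]
    rw [show encSingle F x ρ s = boolPair x (boolPair (encPath F x ρ) (false :: true :: bitString F x s)) from rfl,
      nOfLayout_layoutC]

/-- BLOCK layouts are flagged non-MEAN, with numerator `3` and denominator `16 T(|x|) W(|x|)`.
[cite: AaronsonAmbainis2014, Thm. 23 (proof, p. 14)] -/
theorem node_layoutC_encBlock (u : List Bool) :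
    isMeanC F (layoutC F (encBlock F x ρ u)) = false ∧ nodeNum F (layoutC F (encBlock F x ρ u)) = 3 ∧
      nodeDen F r c k (layoutC F (encBlock F x ρ u)) =
        16 * (F.circ x.length).oracleQueries * bitsToNat (wDenFn F r c k (ones x.length)) := by
  have ht : tagOfC F (layoutC F (encBlock F x ρ u)) = false :: false :: u := tagOfC_layoutC F x _ _
  have hm : isMeanC F (layoutC F (encBlock F x ρ u)) = false := by rw [isMeanC, ht]; rfl
  refine ⟨hm, ?_, ?_⟩
  · rw [nodeNum, hm]; rfl
  · rw [nodeDen, hm]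
    simp only [Bool.false_eq_true, if_false]
    rw [show encBlock F x ρ u = boolPair x (boolPair (encPath F x ρ) (false :: false :: u)) from rfl, nOfLayout_layoutC]

/-- **`W(|x|)` is the reciprocal of the influence threshold**: `pbThreshold F x r c k = 1/⟦wDenFn F r c k 1^{|x|}⟧`.
[cite: AaronsonAmbainis2014, Thm. 23 (proof, p. 14)] -/
theorem pbThreshold_eq_inv_wDenFn_ones : pbThreshold F x r c k = 1 / (bitsToNat (wDenFn F r c k (ones x.length)) : ℝ) := by
  rw [pbThreshold_eq_of_length_eq F r c k (x := x) (x' := ones x.length) (by simp [ones]), pbThreshold_eq_inv_wDenFn]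

/-! ### Both numerals are computed on codes -/

variable {F}

/-- The tag field is computed on codes, for uniform `F`. [cite: AroraBarak2009, §1.3] -/
theorem tagOfCC (hF : F.IsUniform) : CodeFP strE strE (tagOfC F) := by
  have unMul : CodeFP (pairE unE unE) unE (fun p => p.1 * p.2) :=
    ((ulength unitE).comp (unitsMul.comp ((replicateUnit.comp (fst _ _)).pair (replicateUnit.comp (snd _ _))))).congr
      fun p => by simp
  have cF : CodeFP strE strE fstF := ⟨fstF, fstF_mem_FP, fun _ => rfl⟩
  have cSd : CodeFP strE strE sndF := ⟨sndF, sndF_mem_FP, fun _ => rfl⟩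
  have cN : CodeFP strE unE (fun z => nOfLayout z.length) := codeFP_nOfLayout.comp strLength
  have cM : CodeFP strE unE (fun z => blocksOf F (nOfLayout z.length)) :=
    (unSucc.comp ((codeFP_oracleQueries_un F hF).comp cN)).congr fun _ => rfl
  have cInst : CodeFP strE strE (instOfC F) :=
    (cF.comp (strDrop.comp ((unMul.comp (cM.pair cN)).pair (CodeFP.id strE)))).congr fun _ => rfl
  exact (cSd.comp (cSd.comp cInst)).congr fun _ => rfl

/-- The MEAN flag is computed on codes. [cite: AroraBarak2009, §1.3] -/
theorem isMeanCC (hF : F.IsUniform) : CodeFP strE bitE (isMeanC F) :=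
  (strGetD.comp ((const _ 0).pair (tagOfCC hF))).congr fun _ => rfl

/-- **The numerator is computed on codes.** [cite: AroraBarak2009, §1.3] -/
theorem nodeNumC (hF : F.IsUniform) : CodeFP strE natE (nodeNum F) :=
  ((isMeanCC hF).ite
    (natSub.comp ((natMul.comp ((const _ 2).pair (natSub.comp ((strNatLength.comp (tagOfCC hF)).pair (const _ 1))))).pair
      (const _ 1)))
    (const _ 3)).congr fun _ => rfl

end SimTreePB

end Summit.QuantumAdvantage.QuantumAdvantage.Cruxes.TransferPB.Birth

end
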